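import Literature.NumberTheory.LFunctions.WeilSemilocalQuadratic
import Literature.NumberTheory.LFunctions.WeilDilationVirialDeriv
import HarnessLib

/-!
# Motivic door — the semi-local Weil form `Q_S`: locality in `S` and closedness of the positive windows (pub-rhdoor seat lad-2, rung R3, part 1/2)

HONEST FRAMING (verbatim, governs every line below): lottery ticket at the motivic door; RH probability
negligible; consolation prizes are real: a new semi-local Weil-positivity theorem, or a located gap in
the Connes–Consani programme, plus the ff-door theorem.  This file makes NO claim about `ζ`; it proves two
structural facts about the tree's semi-local form `Q_S(g) = W_S(g ⋆ g̃)`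
(`Literature/NumberTheory/LFunctions/WeilSemilocalQuadratic.lean`: Weil's quadratic form with the prime
sum restricted to the `S`-smooth prime powers, `S` a finite set of primes; `WeilSemilocalPositivityOn S a`
= "`Re Q_S(g) ≥ 0` for every test `g ∈ C(a)`, `tsupport g ⊆ [-a, a]`"), used by part 2/2
(`MotivicDoorSemilocalThreshold.lean`, the threshold `a*(S)`):

* §1 LOCALITY IN `S`: on the window `C((log (N+1))/2)` the form `Q_S` only sees which prime powers
  `n ≤ N` are `S`-smooth (`weilSemilocalQuadratic_congr`, `weilSemilocalPositivityOn_congr`), and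
  `Q_S = Q` there when every prime `≤ N` lies in `S` (`weilSemilocalPositivityOn_iff_weilPositivityOn_of_le`,
  the tree's `…_of_forall` extended from `a = (log (N+1))/2` to `a ≤ (log (N+1))/2`); the smoothness
  bookkeeping for `N ≤ 4` (`primeFactors_subset_of_le_four`, `primeFactors_iff_two_of_le_four`).
* §2 CLOSEDNESS — the semi-local analogue of the Lemma 7 step in Yoshida's proof of Prop. 6 (1992,
  p. 320, stated there for the full form): if `Q_S ≥ 0` on `C(b)` for every `0 < b < a` then `Q_S ≥ 0` on
  `C(a)` (`weilSemilocalPositivityOn_of_forall_lt`).  Proof: Bombieri's unitary dilation `g_η`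
  (`weilDilate`, Bombieri 2000 §4) lies in `C(a/(1+η))` for `η > 0`, and `η ↦ Q_S(g_η)` is DIFFERENTIABLE
  (`differentiableAt_weilSemilocalQuadratic_weilDilate`), assembled from the tree's first variation of
  the full functional and of the prime term under rescaling (`hasDerivAt_weilFunctional_comp_mul`,
  `hasDerivAt_weilPrimeTerm_comp_mul`, `WeilRescalingVariation.lean`) and the same statement for the
  `S`-smooth prime term proved here (`hasDerivAt_weilSemilocalPrimeTerm_comp_mul`: near `c₀ > 0` the
  rescaled `S`-smooth prime sum is a FIXED finite sum).

Everything is PROVED with the standard axioms; no named facts, no definitions.  References: H. Yoshida,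
Adv. Stud. Pure Math. 21 (1992) Prop. 6 p. 320 (`Yoshida1992HermitianForms`); E. Bombieri, Rend. Mat.
Acc. Lincei (9) 11 (2000) §4 (`Bombieri2000Weil`); A. Connes, Selecta Math. 5 (1999) §VII Thm 4 (the
semi-local Weil sum, `Connes1999`).  The semi-local statements themselves are new theorems about the
tree's object (cell file `LADDER-R3.md` §2–§3: no finite-`S` threshold statement found in print), not literature.
-/

set_option linter.dupNamespace false  -- the mandated namespace repeats `RiemannHypothesis`

noncomputable section

open Filter Set Metric Literature.NumberTheory.LFunctions
open scoped Topology

namespace Summit.RiemannHypothesis.RiemannHypothesis.Theorems.MotivicDoor.Semilocal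

variable {g k : ℝ → ℂ} {S S' : Finset ℕ}

/-! ## §1  Locality in `S` on a window -/

/-- On indices `n ≤ N` the `S`-smooth coefficient `Λ_S(n)/√n` only depends on which prime powers `n ≤ N`
are `S`-smooth. [folklore] -/
theorem weilSemilocalCoeff_congr {N : ℕ}
    (h : ∀ n ≤ N, IsPrimePow n → (n.primeFactors ⊆ S ↔ n.primeFactors ⊆ S')) {n : ℕ} (hn : n ≤ N) :
    weilSemilocalCoeff S n = weilSemilocalCoeff S' n := by
  by_cases hp : IsPrimePow n
  · unfold weilSemilocalCoeff
    by_cases h1 : n.primeFactors ⊆ S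
    · rw [if_pos h1, if_pos ((h n hn hp).1 h1)]
    · rw [if_neg h1, if_neg fun h2 ↦ h1 ((h n hn hp).2 h2)]
  · rw [weilSemilocalCoeff_of_not_isPrimePow S hp, weilSemilocalCoeff_of_not_isPrimePow S' hp]

/-- Hence the truncated ripples `ρ_{S,N} = ρ_{S',N}` agree. [folklore] -/
theorem weilSemilocalRipple_congr {N : ℕ}
    (h : ∀ n ≤ N, IsPrimePow n → (n.primeFactors ⊆ S ↔ n.primeFactors ⊆ S')) :
    weilSemilocalRipple S N = weilSemilocalRipple S' N := by
  funext t
  unfold weilSemilocalRipple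
  exact Finset.sum_congr rfl fun n hn ↦ by
    rw [weilSemilocalCoeff_congr h (Nat.lt_succ_iff.1 (Finset.mem_range.1 hn))]

/-- Hence the analytic forms `E_{S,N} = E_{S',N}` agree. [folklore] -/
theorem weilSemilocalAnalytic_congr {N : ℕ}
    (h : ∀ n ≤ N, IsPrimePow n → (n.primeFactors ⊆ S ↔ n.primeFactors ⊆ S')) (g : ℝ → ℂ) :
    weilSemilocalAnalytic S N g = weilSemilocalAnalytic S' N g := by
  unfold weilSemilocalAnalytic weilSemilocalWeight
  rw [weilSemilocalRipple_congr h]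

/-- **Locality of `Q_S` in `S`**: if `S` and `S'` contain the same primes among those whose powers are
`≤ N`, then `Q_S(g) = Q_{S'}(g)` for every test function `g ∈ C((log (N+1))/2)`.
[cite: Connes1999, §VII Thm 4 (only the places v ∈ S with a prime power p_v^m ≤ e^{2a} enter on C(a))] -/
theorem weilSemilocalQuadratic_congr (hg : IsWeilTest g) {N : ℕ}
    (h : ∀ n ≤ N, IsPrimePow n → (n.primeFactors ⊆ S ↔ n.primeFactors ⊆ S'))
    (hsupp : tsupport g ⊆ Icc (-(Real.log ((N : ℝ) + 1) / 2)) (Real.log ((N : ℝ) + 1) / 2)) :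
    weilSemilocalQuadratic S g = weilSemilocalQuadratic S' g := by
  rw [weilSemilocalQuadratic_eq_weilSemilocalAnalytic hg S N hsupp,
    weilSemilocalQuadratic_eq_weilSemilocalAnalytic hg S' N hsupp, weilSemilocalAnalytic_congr h]

/-- **Locality of semi-local positivity in `S`** on every window `a ≤ (log (N+1))/2`. [folklore] -/
theorem weilSemilocalPositivityOn_congr {N : ℕ}
    (h : ∀ n ≤ N, IsPrimePow n → (n.primeFactors ⊆ S ↔ n.primeFactors ⊆ S')) {a : ℝ}
    (ha : a ≤ Real.log ((N : ℝ) + 1) / 2) :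
    WeilSemilocalPositivityOn S a ↔ WeilSemilocalPositivityOn S' a := by
  unfold WeilSemilocalPositivityOn
  refine forall₃_congr fun g hg hsupp ↦ ?_
  rw [weilSemilocalQuadratic_congr hg h (hsupp.trans (Icc_subset_Icc (neg_le_neg ha) ha))]

/-- Coincidence with the FULL form on every window `a ≤ (log (N+1))/2` below the first prime missing from
`S` (the tree's `weilSemilocalPositivityOn_iff_weilPositivityOn_of_forall` is the case `a = (log (N+1))/2`).
[cite: ConnesConsani2023, §2.1.2 (only the primes p < λ² enter QW_λ)] -/
theorem weilSemilocalPositivityOn_iff_weilPositivityOn_of_le {N : ℕ}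
    (hS : ∀ n ≤ N, IsPrimePow n → n.primeFactors ⊆ S) {a : ℝ}
    (ha : a ≤ Real.log ((N : ℝ) + 1) / 2) :
    WeilSemilocalPositivityOn S a ↔ WeilPositivityOn a := by
  unfold WeilSemilocalPositivityOn WeilPositivityOn
  refine forall₃_congr fun g hg hsupp ↦ ?_
  rw [weilSemilocalQuadratic_eq_weilQuadratic_of_forall hg hS
    (hsupp.trans (Icc_subset_Icc (neg_le_neg ha) ha))]

/-- Every prime factor of an `n ≤ N` is a prime `≤ N`. [folklore] -/
theorem primeFactors_subset_primesBelow {N n : ℕ} (hn : n ≤ N) :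
    n.primeFactors ⊆ Nat.primesBelow (N + 1) := fun _ hp ↦
  Nat.mem_primesBelow.2
    ⟨Nat.lt_succ_of_le ((Nat.le_of_mem_primeFactors hp).trans hn), Nat.prime_of_mem_primeFactors hp⟩

/-- Every prime power `n ≤ 4` is a power of `2` or `3`. [folklore] -/
theorem primeFactors_subset_of_le_four :
    ∀ n ≤ 4, IsPrimePow n → n.primeFactors ⊆ ({2, 3} : Finset ℕ) := by
  intro n hn hp
  interval_cases n
  · exact absurd hp (by decide)
  · exact absurd hp (by decide)
  · rw [Nat.prime_two.primeFactors]; decide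
  · rw [Nat.prime_three.primeFactors]; decide
  · rw [show (4 : ℕ) = 2 ^ 2 by norm_num, Nat.primeFactors_prime_pow (by norm_num) Nat.prime_two]; decide

/-- For `2 ∈ S`, `3 ∉ S` the prime powers `≤ 4` that are `S`-smooth are exactly the `{2}`-smooth ones. [folklore] -/
theorem primeFactors_iff_two_of_le_four (h2 : 2 ∈ S) (h3 : 3 ∉ S) :
    ∀ n ≤ 4, IsPrimePow n → (n.primeFactors ⊆ S ↔ n.primeFactors ⊆ ({2} : Finset ℕ)) := by
  intro n hn hp
  interval_cases n
  · exact absurd hp (by decide)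
  · exact absurd hp (by decide)
  · rw [Nat.prime_two.primeFactors]; simp [h2]
  · rw [Nat.prime_three.primeFactors]; simp [h3]
  · rw [show (4 : ℕ) = 2 ^ 2 by norm_num, Nat.primeFactors_prime_pow (by norm_num) Nat.prime_two]; simp [h2]

/-- `log 2 ≤ (log 5)/2` (`4 ≤ 5`). [folklore] -/
theorem log_two_le_log_five_half : Real.log 2 ≤ Real.log 5 / 2 := by
  have h4 : Real.log 4 = 2 * Real.log 2 := by
    rw [show (4 : ℝ) = 2 ^ 2 by norm_num, Real.log_pow]; norm_num
  have h45 : Real.log 4 ≤ Real.log 5 := Real.log_le_log (by norm_num) (by norm_num)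
  linarith

/-- The window of `N = 4` is `(log 5)/2`. [folklore] -/
theorem log_five_half_eq : Real.log (((4 : ℕ) : ℝ) + 1) / 2 = Real.log 5 / 2 := by norm_num

/-! ## §2  Closedness: the semi-local form along Bombieri's dilation -/

/-- The `S`-smooth prime term as a finite sum when the kernel vanishes for `|u| > R`. [folklore] -/
theorem weilSemilocalPrimeTerm_eq_sum_of_radius (S : Finset ℕ) {f : ℝ → ℂ} {R : ℝ}
    (hf : ∀ u : ℝ, R < |u| → f u = 0) :
    weilSemilocalPrimeTerm S f = ∑ n ∈ Finset.range ⌈Real.exp (R + 1)⌉₊,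
      (weilSemilocalCoeff S n : ℂ) * (f (Real.log n) + f (-Real.log n)) := by
  unfold weilSemilocalPrimeTerm
  refine tsum_eq_sum fun n hn ↦ ?_
  rw [Finset.mem_range, not_lt] at hn
  have hn' : Real.exp (R + 1) ≤ n := (Nat.le_ceil _).trans (by exact_mod_cast hn)
  have hpos : (0 : ℝ) < n := (Real.exp_pos _).trans_le hn'
  have hlog : R + 1 ≤ Real.log n := by rwa [Real.le_log_iff_exp_le hpos]
  have h1 : R < |Real.log n| := lt_of_lt_of_le (by linarith) (le_abs_self _)
  rw [hf _ h1, hf _ (by rwa [abs_neg]), add_zero, mul_zero]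

/-- **The `S`-smooth prime term of a rescaling, differentiated**: on `|c - c₀| < c₀/2` the rescaled prime
sum of `k(c ·)` is a FIXED finite sum, each term differentiable in `c`;
`d/dc|_{c₀} Σₙ Λ_S(n) n^{-1/2}(k(c log n) + k(-c log n)) = Σₙ Λ_S(n) n^{-1/2}((D k)(log n) + (D k)(-log n))`,
`(D k)(t) = t k'(c₀ t)` (verbatim the tree's `hasDerivAt_weilPrimeTerm_comp_mul` with `Λ_S` for `Λ`). [folklore] -/
theorem hasDerivAt_weilSemilocalPrimeTerm_comp_mul (S : Finset ℕ) (hk : IsWeilTest k) {c₀ : ℝ}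
    (hc₀ : 0 < c₀) :
    HasDerivAt (fun c : ℝ ↦ weilSemilocalPrimeTerm S (fun t ↦ k (c * t)))
      (weilSemilocalPrimeTerm S (fun t : ℝ ↦ (t : ℂ) * deriv k (c₀ * t))) c₀ := by
  obtain ⟨A, hA0, hAk, hAd⟩ := exists_radius_of_isWeilTest hk
  set R : ℝ := 2 * A / c₀ with hR
  have hR0 : 0 ≤ R := by positivity
  have hAR : A = c₀ / 2 * R := by rw [hR]; field_simp
  set N : ℕ := ⌈Real.exp (R + 1)⌉₊ with hN
  -- on the ball, the kernel `k(c ·)` vanishes for `|u| > R`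
  have hvan : ∀ c ∈ ball c₀ (c₀ / 2), ∀ u : ℝ, R < |u| → k (c * u) = 0 := by
    intro c hc u hu
    have hc' : c₀ / 2 < c := by
      rw [mem_ball, Real.dist_eq] at hc
      linarith [neg_abs_le (c - c₀)]
    refine hAk _ ?_
    rw [abs_mul, abs_of_pos (by linarith)]
    calc A = c₀ / 2 * R := hAR
      _ ≤ c₀ / 2 * |u| := by gcongr
      _ < c * |u| := mul_lt_mul_of_pos_right hc' (hR0.trans_lt hu)
  have hvan' : ∀ u : ℝ, R < |u| → (u : ℂ) * deriv k (c₀ * u) = 0 := by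
    intro u hu
    have : deriv k (c₀ * u) = 0 := by
      refine hAd _ ?_
      rw [abs_mul, abs_of_pos hc₀]
      calc A = c₀ / 2 * R := hAR
        _ ≤ c₀ / 2 * |u| := by gcongr
        _ < c₀ * |u| := mul_lt_mul_of_pos_right (by linarith) (hR0.trans_lt hu)
    simp [this]
  -- the finite sum and its derivative
  have hsum : HasDerivAt (fun c : ℝ ↦ ∑ n ∈ Finset.range N,
      (weilSemilocalCoeff S n : ℂ) * (k (c * Real.log n) + k (c * -Real.log n)))
      (∑ n ∈ Finset.range N, (weilSemilocalCoeff S n : ℂ) *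
        (((Real.log n : ℝ) : ℂ) * deriv k (c₀ * Real.log n) +
          ((-Real.log n : ℝ) : ℂ) * deriv k (c₀ * -Real.log n))) c₀ := by
    refine HasDerivAt.fun_sum fun n _ ↦ ?_
    exact ((hasDerivAt_comp_mul_param hk (Real.log n) c₀).add
      (hasDerivAt_comp_mul_param hk (-Real.log n) c₀)).const_mul _
  have heq : (fun c : ℝ ↦ weilSemilocalPrimeTerm S (fun t ↦ k (c * t))) =ᶠ[𝓝 c₀] fun c : ℝ ↦
      ∑ n ∈ Finset.range N,
        (weilSemilocalCoeff S n : ℂ) * (k (c * Real.log n) + k (c * -Real.log n)) := by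
    filter_upwards [ball_mem_nhds c₀ (by positivity : (0 : ℝ) < c₀ / 2)] with c hc
    exact weilSemilocalPrimeTerm_eq_sum_of_radius S (hvan c hc)
  refine (hsum.congr_of_eventuallyEq heq).congr_deriv ?_
  rw [weilSemilocalPrimeTerm_eq_sum_of_radius S hvan']

/-- `W_S = W + (Σ_Λ − Σ_{Λ_S})`: the semi-local functional is the full one plus the non-`S`-smooth prime
powers put back. [folklore] -/
theorem weilSemilocalFunctional_eq_weilFunctional_add (S : Finset ℕ) (k : ℝ → ℂ) :
    weilSemilocalFunctional S k =
      weilFunctional k + (weilPrimeTerm k - weilSemilocalPrimeTerm S k) := by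
  unfold weilSemilocalFunctional weilFunctional
  ring

/-- **First variation of the semi-local functional under rescaling**: `c ↦ W_S(k(c ·))` is
differentiable at every `c₀ > 0`. [folklore] -/
theorem hasDerivAt_weilSemilocalFunctional_comp_mul (S : Finset ℕ) (hk : IsWeilTest k) {c₀ : ℝ}
    (hc₀ : 0 < c₀) :
    HasDerivAt (fun c : ℝ ↦ weilSemilocalFunctional S (fun t ↦ k (c * t)))
      (weilFunctional (fun t : ℝ ↦ (t : ℂ) * deriv k (c₀ * t)) +
        (weilPrimeTerm (fun t : ℝ ↦ (t : ℂ) * deriv k (c₀ * t)) -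
          weilSemilocalPrimeTerm S (fun t : ℝ ↦ (t : ℂ) * deriv k (c₀ * t)))) c₀ := by
  have e : (fun c : ℝ ↦ weilSemilocalFunctional S (fun t ↦ k (c * t))) = fun c : ℝ ↦
      weilFunctional (fun t ↦ k (c * t)) +
        (weilPrimeTerm (fun t ↦ k (c * t)) - weilSemilocalPrimeTerm S (fun t ↦ k (c * t))) := by
    funext c
    exact weilSemilocalFunctional_eq_weilFunctional_add S _
  rw [e]
  exact (hasDerivAt_weilFunctional_comp_mul hk hc₀).add
    ((hasDerivAt_weilPrimeTerm_comp_mul hk hc₀).sub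
      (hasDerivAt_weilSemilocalPrimeTerm_comp_mul S hk hc₀))

/-- `Q_S(g_η) = W_S(k((1+η) ·))`, `k = g ⋆ g̃`, for `η > -1` (the autocorrelation of a dilate is the
rescaled autocorrelation, `weilConv_weilDilate_weilReflect`). [cite: Bombieri2000Weil, §4 proof of Thm 5 (the dilation)] -/
theorem weilSemilocalQuadratic_weilDilate (S : Finset ℕ) (g : ℝ → ℂ) {η : ℝ} (hη : -1 < η) :
    weilSemilocalQuadratic S (weilDilate η g) =
      weilSemilocalFunctional S (fun t ↦ weilConv g (weilReflect g) ((1 + η) * t)) := by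
  rw [weilSemilocalQuadratic, weilConv_weilDilate_weilReflect g hη]

/-- **`η ↦ Q_S(g_η)` is differentiable at every `η₀ > -1`** along Bombieri's dilation. [folklore] -/
theorem differentiableAt_weilSemilocalQuadratic_weilDilate (S : Finset ℕ) (hg : IsWeilTest g) {η₀ : ℝ}
    (hη₀ : -1 < η₀) :
    DifferentiableAt ℝ (fun η : ℝ ↦ weilSemilocalQuadratic S (weilDilate η g)) η₀ := by
  set k : ℝ → ℂ := weilConv g (weilReflect g) with hk_def
  have hk : IsWeilTest k := hg.weilConv hg.weilReflect
  have hc₀ : 0 < 1 + η₀ := by linarith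
  have heq : (fun η : ℝ ↦ weilSemilocalQuadratic S (weilDilate η g)) =ᶠ[𝓝 η₀]
      fun η ↦ weilSemilocalFunctional S (fun t ↦ k ((1 + η) * t)) := by
    filter_upwards [Ioi_mem_nhds hη₀] with η hη
    exact weilSemilocalQuadratic_weilDilate S g hη
  have hinner : HasDerivAt (fun η : ℝ ↦ 1 + η) 1 η₀ := by
    simpa using (hasDerivAt_id η₀).const_add 1
  have hcore := hasDerivAt_weilSemilocalFunctional_comp_mul S hk hc₀
  have hcomp := hcore.scomp η₀ hinner
  exact (hcomp.congr_of_eventuallyEq heq).differentiableAt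

/-- Hence `η ↦ Re Q_S(g_η)` is continuous at `η = 0`. [folklore] -/
theorem continuousAt_re_weilSemilocalQuadratic_weilDilate (S : Finset ℕ) (hg : IsWeilTest g) :
    ContinuousAt (fun η : ℝ ↦ (weilSemilocalQuadratic S (weilDilate η g)).re) 0 :=
  Complex.continuous_re.continuousAt.comp
    (differentiableAt_weilSemilocalQuadratic_weilDilate S hg (by norm_num)).continuousAt

/-- **Closedness of the set of semi-locally positive windows** (semi-local analogue of the Lemma 7 step
in Yoshida's proof of Prop. 6, p. 320): if `Q_S ≥ 0` on every strictly smaller cone `C(b)`, `0 < b < a`,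
then `Q_S ≥ 0` on `C(a)`.  Proof: for `η > 0` the dilate `g_η` lies in `C(a/(1+η))`, and
`Re Q_S(g) = lim_{η → 0⁺} Re Q_S(g_η) ≥ 0`. [cite: Yoshida1992HermitianForms, Prop. 6 (p. 320) with Lemma 7 (p. 312) — the full-form argument, transposed] -/
theorem weilSemilocalPositivityOn_of_forall_lt {S : Finset ℕ} {a : ℝ} (ha : 0 < a)
    (h : ∀ b : ℝ, 0 < b → b < a → WeilSemilocalPositivityOn S b) :
    WeilSemilocalPositivityOn S a := by
  intro g hg hsupp
  have hcont : Tendsto (fun η : ℝ ↦ (weilSemilocalQuadratic S (weilDilate η g)).re) (𝓝[>] 0)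
      (𝓝 ((weilSemilocalQuadratic S (weilDilate 0 g)).re)) :=
    (continuousAt_re_weilSemilocalQuadratic_weilDilate S hg).tendsto.mono_left nhdsWithin_le_nhds
  rw [weilDilate_zero] at hcont
  refine ge_of_tendsto hcont (eventually_nhdsWithin_of_forall fun η (hη : 0 < η) ↦ ?_)
  have hη' : (-1 : ℝ) < η := by linarith
  have hlt : a / (1 + η) < a := by
    rw [div_lt_iff₀ (by linarith : (0 : ℝ) < 1 + η)]
    nlinarith
  have hpos : 0 < a / (1 + η) := div_pos ha (by linarith)
  exact h (a / (1 + η)) hpos hlt (weilDilate η g) (hg.weilDilate hη')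
    (tsupport_weilDilate_subset g hη' hsupp)


end Summit.RiemannHypothesis.RiemannHypothesis.Theorems.MotivicDoor.Semilocal

end
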